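import Literature.Computability.MetaComplexity.GGM
import HarnessLib

/-!
# Walking the distinguisher tree along the binary digits of a leaf number (proofs)

Part of the proof architecture of the named fact `AllenderEtAl2006_MCSP_universalInverter`
(`MCSPUniversalInverter.lean`; Allender–Buhrman–Koucký–van Melkebeek–Ronneburger 2006, Thm. 45
with §4.2): groundwork for the polynomial-time machine that writes down the truth table of a
hybrid of the GGM tree (the machine behind "a probabilistic oracle machine `M` using `L` that
distinguishes `G_y` from the uniform distribution", proof of Thm. 45, p. 24 of the author
version; Razborov–Rudich 1997, proof of Thm. 4.1). The truth table lists the leaves in the order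
of `boolFunEquivFin` (`TruthTables.lean`), i.e. leaf number `t < 2ᵏ` has the path whose `j`-th
step bit is the binary digit `t.testBit j`; the trees of `MetaComplexity/GGM.lean` (`distLab`)
are defined by structural recursion on paths, peeling the LAST step first. A machine instead
walks DOWN from the root, and needs the labels of the ancestors of leaf `t` in arithmetic form:

* `boolFunEquivFin_symm_apply_eq_testBit` — the standard enumeration reads binary digits;
* `nodeIdx_ancestor` — the ancestor of leaf `t` at depth `e ≤ k` has node number
  `2ᵉ − 1 + ⌊t / 2^{k−e}⌋`;
* `distLab_ancestor_succ` — **one step down**: the label of the depth-`(e+1)` ancestor is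
  obtained from the label of the depth-`e` ancestor by the rule of `distLab` at node number
  `2ᵉ − 1 + ⌊t / 2^{k−e}⌋` with step bit `t.testBit (k − e − 1)`;
* `distLab_ancestor_self` — at depth `k` the ancestor is the leaf itself.

Theorems only.

## References

* E. Allender et al., *Power from random strings*, SIAM J. Comput. 35(6) (2006)
  [AllenderEtAl2006]: proof of Thm. 45 (p. 24).
* A. A. Razborov, S. Rudich, *Natural proofs*, JCSS 55 (1997) [RazborovRudich1997]: proof of
  Thm. 4.1.
* S. Arora, B. Barak, *Computational Complexity: A Modern Approach*, CUP 2009 [AroraBarak2009]: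
  Thm. 9.17, Fig. 9.2 (the GGM tree; heap numbering of its nodes).
-/

namespace Literature.Computability.MetaComplexity

open Complexity Finset

/-! ### Binary digits of the standard enumeration -/

/-- **The standard enumeration of the cube reads binary digits**: the `j`-th coordinate of the
`t`-th point of `{0,1}ᵏ` (order `boolFunEquivFin`, least significant digit first) is
`t.testBit j`. [cite: AroraBarak2009, Thm. 9.17 (leaf order of the truth table)] [folklore] -/
theorem boolFunEquivFin_symm_apply_eq_testBit (k : ℕ) (t : Fin (2 ^ k)) (j : Fin k) :
    (boolFunEquivFin k).symm t j = (t : ℕ).testBit j := by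
  simp only [boolFunEquivFin, Equiv.symm_trans_apply, Equiv.arrowCongr_symm,
    Equiv.arrowCongr_apply, Equiv.symm_symm, Equiv.coe_refl, Function.comp_apply, id_eq,
    finTwoEquiv, Equiv.coe_fn_mk, Nat.testBit_eq_decide_div_mod_eq]
  rcases Nat.mod_two_eq_zero_or_one ((t : ℕ) / 2 ^ (j : ℕ)) with h | h
  · simp [h, Fin.ext_iff]
  · simp [h, Fin.ext_iff]

/-- A point of the cube whose coordinates are the binary digits of `N < 2ᵉ` is the `N`-th point.
[folklore] -/
theorem boolFunEquivFin_apply_eq_of_testBit {e : ℕ} (q : Fin e → Bool) {N : ℕ} (hN : N < 2 ^ e)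
    (h : ∀ j : Fin e, q j = N.testBit j) : (boolFunEquivFin e q : ℕ) = N := by
  have hq : q = (boolFunEquivFin e).symm ⟨N, hN⟩ :=
    funext fun j => by rw [h, boolFunEquivFin_symm_apply_eq_testBit]
  rw [hq, Equiv.apply_symm_apply]

/-! ### Ancestors of a leaf -/

/-- **Node number of an ancestor.** The ancestor at depth `e ≤ k` of the leaf with number
`t < 2ᵏ` — the node whose path consists of the top `e` digits of `t` — has heap number
`2ᵉ − 1 + ⌊t / 2^{k−e}⌋`. [cite: AroraBarak2009, Thm. 9.17 Fig. 9.2] [folklore] -/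
theorem nodeIdx_ancestor (k : ℕ) (t : Fin (2 ^ k)) (e : ℕ) (he : e ≤ k) :
    nodeIdx e (fun j : Fin e => (boolFunEquivFin k).symm t ⟨j + (k - e), by omega⟩) =
      2 ^ e - 1 + (t : ℕ) / 2 ^ (k - e) := by
  unfold nodeIdx
  congr 1
  apply boolFunEquivFin_apply_eq_of_testBit
  · rw [Nat.div_lt_iff_lt_mul (Nat.two_pow_pos _), ← pow_add]
    have : e + (k - e) = k := by omega
    rw [this]
    exact t.isLt
  · intro j
    rw [boolFunEquivFin_symm_apply_eq_testBit, Nat.testBit_div_two_pow]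

/-- **One step down the distinguisher tree, arithmetically.** The label of the depth-`(e+1)`
ancestor of leaf `t` is computed from the label of its depth-`e` ancestor by the rule of
`distLab` at node number `n = 2ᵉ − 1 + ⌊t / 2^{k−e}⌋` with step bit `b = t.testBit (k−e−1)`:
a fresh label `ρ n b` if `n < i`, the challenge `z b` if `n = i`, and `g b (label)` otherwise.
[cite: AroraBarak2009, proof of Thm. 9.17 p. 228] [cite: RazborovRudich1997, Thm. 4.1 proof] -/
theorem distLab_ancestor_succ {σ : Type*} (g : Bool → σ → σ) (ρ : ℕ → Bool → σ) (x : σ) (i : ℕ)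
    (z : Bool → σ) (k : ℕ) (t : Fin (2 ^ k)) (e : ℕ) (he : e < k) :
    distLab g ρ x i z (e + 1)
        (fun j : Fin (e + 1) => (boolFunEquivFin k).symm t ⟨j + (k - (e + 1)), by omega⟩) =
      if 2 ^ e - 1 + (t : ℕ) / 2 ^ (k - e) < i then
        ρ (2 ^ e - 1 + (t : ℕ) / 2 ^ (k - e)) ((t : ℕ).testBit (k - e - 1))
      else if 2 ^ e - 1 + (t : ℕ) / 2 ^ (k - e) = i then z ((t : ℕ).testBit (k - e - 1))
      else g ((t : ℕ).testBit (k - e - 1))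
        (distLab g ρ x i z e
          (fun j : Fin e => (boolFunEquivFin k).symm t ⟨j + (k - e), by omega⟩)) := by
  rw [distLab_succ]
  have htail : Fin.tail (fun j : Fin (e + 1) =>
      (boolFunEquivFin k).symm t ⟨j + (k - (e + 1)), by omega⟩) =
        fun j : Fin e => (boolFunEquivFin k).symm t ⟨j + (k - e), by omega⟩ := by
    funext j
    simp only [Fin.tail]
    exact congrArg _ (Fin.ext (by simp only [Fin.val_succ]; omega))
  have h0 : ∀ h, (boolFunEquivFin k).symm t ⟨((0 : Fin (e + 1)) : ℕ) + (k - (e + 1)), h⟩ =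
      (t : ℕ).testBit (k - e - 1) := fun h => by
    rw [boolFunEquivFin_symm_apply_eq_testBit]
    congr 1
    simp only [Fin.val_zero]
    omega
  rw [htail, nodeIdx_ancestor k t e he.le, h0]

/-- **At depth `k` the ancestor is the leaf itself**: the path of the top `k` digits of `t` is the
`t`-th point of the cube. [folklore] -/
theorem ancestor_self (k : ℕ) (t : Fin (2 ^ k)) :
    (fun j : Fin k => (boolFunEquivFin k).symm t ⟨j + (k - k), by omega⟩) =
      (boolFunEquivFin k).symm t := by
  funext j
  exact congrArg _ (Fin.ext (by simp))

/-- The leaf label as the end of the walk from the root. [folklore] -/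
theorem distLab_ancestor_self {σ : Type*} (g : Bool → σ → σ) (ρ : ℕ → Bool → σ) (x : σ) (i : ℕ)
    (z : Bool → σ) (k : ℕ) (t : Fin (2 ^ k)) :
    distLab g ρ x i z k (fun j : Fin k => (boolFunEquivFin k).symm t ⟨j + (k - k), by omega⟩) =
      distLab g ρ x i z k ((boolFunEquivFin k).symm t) := by
  rw [ancestor_self]

/-- The walk starts at the root label. [folklore] -/
theorem distLab_ancestor_zero {σ : Type*} (g : Bool → σ → σ) (ρ : ℕ → Bool → σ) (x : σ) (i : ℕ)
    (z : Bool → σ) (k : ℕ) (t : Fin (2 ^ k)) :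
    distLab g ρ x i z 0 (fun j : Fin 0 => (boolFunEquivFin k).symm t ⟨j + (k - 0), by omega⟩) =
      x := rfl

/-- **The `t`-th bit of the truth table of a hybrid** is the read-out of the label of leaf `t`,
reached by the walk. [cite: AroraBarak2009, Thm. 9.17 (leaf order of the truth table)] -/
theorem getD_truthTable_distFun {σ : Type*} [Inhabited σ] {k : ℕ} (g : Bool → σ → σ)
    (o : σ → Bool) (ω : Sample σ k) (i : ℕ) (z : Bool → σ) (t : Fin (2 ^ k)) :
    (truthTable (distFun g o ω i z)).getD t false =
      o (distLab g ω.rho ω.1 i z k ((boolFunEquivFin k).symm t)) := by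
  rw [List.getD_eq_getElem _ _ (by simp)]
  simp [truthTable, distFun]

end Literature.Computability.MetaComplexity
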